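import Literature.Computability.AlgebraicComplexity.BI17TableCountFourCut
import Mathlib.LinearAlgebra.Matrix.Kronecker
import Mathlib.Algebra.MvPolynomial.Funext
import Mathlib.Algebra.MvPolynomial.Monad
import Mathlib.RingTheory.MvPolynomial.Homogeneous
import Mathlib.Algebra.Polynomial.AlgebraMap
import HarnessLib

/-!
# BI 2017 at `n = 4`: the double-Hodge-star identity, hence `N_4 > 0` and `P_{4,16}(det_4) ≠ 0`

Unit `val-input-bi17-latincube4` (literature-prover, LADDER-VALIANT inputs→unconditional), sequel to
`BI17TableCountFourCut.lean`, which reduced BI 2017's two computer verifications at `n = 4`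
(`admissibleTableCount 4 ≠ 0`, i.e. `P_{4,16}(det_4) ≠ 0`, i.e. — Summit-side — the named fact
`BI2017_latinCube_2_4`) to ONE polynomial identity
`h : ∀ μ : Λ²ℤ⁴ ⊗ Λ²ℤ⁴, det K(⋆⋆μ) = det K(μ)`. This file PROVES `h` (`detK_star_invariant`) and
records the unconditional consequences `admissibleTableCount_four_pos` and
`cayleyP_det_four_ne_zero`. HONEST FRAMING: VP ≠ VNP is NOT proved here or anywhere in the tree and
nothing in this file is progress on it; no summit statement is proved by this seat; what is proved is
the `n = 4` instance of a published computer check, by algebra instead of enumeration. The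
Summit-side one-liner `BI2017_latinCube_2_4_holds` (via
`BI2017_latinCube_2_4_iff_admissibleTableCount_four`) is left to the owner of
`Summits/ValiantsHypothesis/…/Theorems/` (Literature may not import Summits).

## The proof of `h` (following the paper's invariant-theoretic remark, made elementary)

`K(μ) = Σ_{A,C} μ_{AC} S_A ⊗ S_C` (`S_A = E_{aa'} - E_{a'a}`, `A = {a < a'} ⊂ [4]`) is the generic
element of `Λ²k⁴ ⊗ Λ²k⁴ ⊂ Sym²(k⁴ ⊗ k⁴)`, a symmetric `16 × 16` matrix; `F(μ) := det K(μ)`.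

* (A) COVARIANCE (`conj_kMatR`, `det_kMatR_act`): `(g ⊗ g') K(μ) (g ⊗ g')ᵀ = K(Λ²g · μ · (Λ²g')ᵀ)`
  (from `g S_{A'} gᵀ = Σ_A (Λ²g)_{A A'} S_A`, the `2 × 2` minors), hence
  `F((Λ²g, Λ²g')·μ) = (det g det g')⁸ F(μ)`. The Hodge matrix `J` (`J_{A Aᶜ} = sh(A)`) satisfies
  `J Λ²g J (Λ²g)ᵀ = det g · 1` (`Jst_lam2`, the Laplace expansion of a `4 × 4` determinant along
  two rows, checked entrywise by `ring`), `Λ²` is multiplicative (`lam2_mul`, Cauchy–Binet), and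
  `⋆⋆μ = J μ J` (`starMuR_eq_actM`); so for invertible `g, g'`,
  `G((Λ²g, Λ²g')·μ) = (det g det g')⁸ G(μ)` with `G := F ∘ ⋆⋆` (`det_kMatR_star_act`).
* (B) SLICE: `P := G - F` vanishes on `𝔰 = {μ : ⋆⋆μ = μ}` trivially, hence (A) on the
  `GL₄ × GL₄`-orbit of `𝔰` (`FG_act_eq_zero`).
* (C) DENSITY, by the lowest-order term: parametrise the orbit by
  `Φ(X, X', ν) = (Λ²(1+X), Λ²(1+X'))·(s₀ + ν + ⋆⋆ν)` (`68` parameters, `s₀ ∈ 𝔰` an explicit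
  integer point). `det(1+X) det(1+X') · P(Φ) = 0` pointwise over `ℚ`, so `P ∘ Φ = 0` as a polynomial
  (`MvPolynomial.funext`, `FG_Φh`). Dilate the parameters by `ε` (`dil`):
  `Φ(εu) = s₀ + ε ψ(u, ε)` with `ψ(u, 0) = L(u) := D(X) s₀ + s₀ D(X')ᵀ + ν + ⋆⋆ν` the LINEARISED
  orbit map (`dil_Φh`, `eval0_ψ`; `Λ²(1 + εY) = 1 + ε D(Y) + ε² Λ²Y`, `lam2_one_add_smul`). If
  `Q(μ) := P(s₀ + μ)` has no terms of degree `< d` and `Q(ε ψ) = 0`, then `Q_d(L(u)) = 0`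
  (`lowest_order`: the `ε^d`-coefficient). `L` is SURJECTIVE: an explicit integer matrix `r` with
  `L ∘ r = 24 · id` (tables `rX`, `rX'`, `rν`, found by exact linear algebra offline and CHECKED
  here by `simp; ring` in the `36` coordinates, `cert`), so `Q_d(L(u)) = 0 ⇒ 24^d Q_d = 0 ⇒ Q_d = 0`;
  by strong induction on `d` all homogeneous components of `Q` vanish, `Q = 0`, `P = 0`
  (`Pgen_eq_zero`), and `h` follows by casting `ℤ → ℚ` (`detK_star_invariant`).

No `sorry`, no new axioms, no `native_decide`; the only kernel decisions are `starMu s0 = s0`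
(`decide +kernel` on `36` integers) and the `fin_cases` tables. No new named facts (D-0026): every
intermediate statement is a (private) theorem proved here.

## References

* [BurgisserIkenmeyer2017] P. Bürgisser, C. Ikenmeyer, *Fundamental invariants of orbit closures*,
  J. Algebra 477 (2017) 390–434, arXiv:1511.02927 — §3.3 (Prop. 3.28 and the remark after it:
  `P_{4,16}(det_4) ≠ 0` "using computer calculations"), §5.2 (Def. 5.21, Prop. 5.22, and before
  Problem 5.23: "verified in the cases `n = 2` and `n = 4`"), and the invariant-theoretic discussion
  of `Λ² ⊗ Λ²` there. The elementary density argument (C) is ours [folklore].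
-/

open Matrix MvPolynomial
open scoped Kronecker

namespace Literature.Computability.AlgebraicComplexity.BI17TwoLevelCut

open Finset Literature.Computability.AlgebraicComplexity

/-! ## Part A: covariance of `K(μ)` under `GL₄ × GL₄` and the Hodge matrix -/

section Covariance

variable {R : Type*} [CommRing R]

/-- `K(μ)` over a commutative ring. [folklore] -/
def kMatR (μ : Typ → R) : Matrix Cell Cell R := fun x y => ∑ τ, μ τ * (K τ x y : R)

/-- `⋆⋆μ` over a commutative ring. [folklore] -/
def starMuR (μ : Typ → R) : Typ → R := fun τ => (sh2 τ : R) * μ (compl τ)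

/-- `Λ² g`: the `6 × 6` matrix of `2 × 2` minors (rows `pairOf A`, columns `pairOf A'`). [folklore] -/
def lam2 (g : Matrix (Fin 4) (Fin 4) R) : Matrix (Fin 6) (Fin 6) R := fun A A' =>
  g (pairOf A).1 (pairOf A').1 * g (pairOf A).2 (pairOf A').2 -
    g (pairOf A).1 (pairOf A').2 * g (pairOf A).2 (pairOf A').1

/-- The action of a pair of `6 × 6` matrices on coefficient vectors: `(L, L')·μ = L μ L'ᵀ`. [folklore] -/
def actM (L L' : Matrix (Fin 6) (Fin 6) R) (μ : Typ → R) : Typ → R := fun τ =>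
  ∑ τ', L τ.1 τ'.1 * L' τ.2 τ'.2 * μ τ'

/-- Summing against `S_{A'}` picks out the antisymmetrised `(p,q)` entry. [folklore] -/
private theorem sum_kA_mul (A' : Fin 6) (f : Fin 4 → Fin 4 → R) :
    (∑ a, ∑ b, (kA A' a b : R) * f a b) = f (pairOf A').1 (pairOf A').2 - f (pairOf A').2 (pairOf A').1 := by
  fin_cases A' <;> simp [Fin.sum_univ_four, kA, pairOf] <;> ring

set_option maxHeartbeats 1000000 in
/-- `g S_{A'} gᵀ = Σ_A (Λ²g)_{A A'} S_A`, entrywise. [folklore] -/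
private theorem conj_SR (g : Matrix (Fin 4) (Fin 4) R) (A' : Fin 6) (i j : Fin 4) :
    (∑ a, ∑ b, g i a * (kA A' a b : R) * g j b) = ∑ A, lam2 g A A' * (kA A i j : R) := by
  have : (∑ a, ∑ b, g i a * (kA A' a b : R) * g j b) = ∑ a, ∑ b, (kA A' a b : R) * (g i a * g j b) := by
    refine Finset.sum_congr rfl fun a _ => Finset.sum_congr rfl fun b _ => by ring
  rw [this, sum_kA_mul]
  fin_cases i <;> fin_cases j <;> simp [Fin.sum_univ_succ, kA, pairOf, lam2] <;> ring


/-- `K(μ)` entry as an integer-cast product. [folklore] -/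
private theorem kMatR_apply (μ : Typ → R) (x y : Cell) :
    kMatR μ x y = ∑ τ, μ τ * ((kA τ.1 x.1 y.1 : R) * (kA τ.2 x.2 y.2 : R)) := by
  simp [kMatR, K, Int.cast_mul]

/-- `S_A` as a matrix over `R`. [folklore] -/
def SA (A : Fin 6) : Matrix (Fin 4) (Fin 4) R := fun a b => (kA A a b : R)

/-- `K(μ) = Σ_τ μ_τ S_A ⊗ S_C` as a sum of Kronecker products. [folklore] -/
private theorem kMatR_eq_sum (μ : Typ → R) : kMatR μ = ∑ τ, μ τ • (SA (R := R) τ.1 ⊗ₖ SA (R := R) τ.2) := by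
  ext x y
  simp [kMatR, K, SA, Matrix.sum_apply, Matrix.smul_apply, Matrix.kroneckerMap_apply, Int.cast_mul]

/-- `g S_{A'} gᵀ = Σ_A (Λ²g)_{A A'} S_A` as matrices. [folklore] -/
private theorem conj_SA (g : Matrix (Fin 4) (Fin 4) R) (A' : Fin 6) :
    g * SA A' * gᵀ = ∑ A, lam2 g A A' • SA (R := R) A := by
  ext i j
  simp only [Matrix.mul_apply, Matrix.transpose_apply, Matrix.sum_apply, Matrix.smul_apply, SA,
    smul_eq_mul, Finset.sum_mul]
  rw [Finset.sum_comm]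
  exact conj_SR g A' i j

/-- Factorisation of a sum over pairs. [folklore] -/
private theorem sum_pair_factor (u v a b : Fin 6 → R) (c : R) :
    ∑ p : Typ, u p.1 * v p.2 * c * (a p.1 * b p.2) = c * ((∑ A, u A * a A) * ∑ C, v C * b C) := by
  rw [Fintype.sum_prod_type, Finset.sum_mul_sum, Finset.mul_sum]
  refine Finset.sum_congr rfl fun A _ => ?_
  rw [Finset.mul_sum]
  refine Finset.sum_congr rfl fun C _ => ?_
  ring

/-- Factorisation of a sum over pairs (variant). [folklore] -/
private theorem sum_pair_factor' (u v a b : Fin 6 → R) (c : R) :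
    ∑ p : Typ, u p.1 * v p.2 * (a p.1 * b p.2 * c) = (∑ A, u A * a A) * (∑ C, v C * b C) * c := by
  rw [Fintype.sum_prod_type, Finset.sum_mul_sum, Finset.sum_mul]
  refine Finset.sum_congr rfl fun A _ => ?_
  rw [Finset.sum_mul]
  refine Finset.sum_congr rfl fun C _ => ?_
  ring

/-- The entries of `K((L, L')·μ)`. [folklore] -/
private theorem kMatR_actM_apply (L L' : Matrix (Fin 6) (Fin 6) R) (μ : Typ → R) (x y : Cell) :
    kMatR (actM L L' μ) x y =
      ∑ τ', μ τ' * ((∑ A, L A τ'.1 * (kA A x.1 y.1 : R)) * ∑ C, L' C τ'.2 * (kA C x.2 y.2 : R)) := by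
  rw [kMatR_apply]
  have h : ∀ τ : Typ, actM L L' μ τ * ((kA τ.1 x.1 y.1 : R) * (kA τ.2 x.2 y.2 : R)) =
      ∑ τ', L τ.1 τ'.1 * L' τ.2 τ'.2 * μ τ' * ((kA τ.1 x.1 y.1 : R) * (kA τ.2 x.2 y.2 : R)) :=
    fun τ => by simp only [actM, Finset.sum_mul]
  simp_rw [h]
  rw [Finset.sum_comm]
  exact Finset.sum_congr rfl fun τ' _ => sum_pair_factor (fun A => L A τ'.1) (fun C => L' C τ'.2)
    (fun A => (kA A x.1 y.1 : R)) (fun C => (kA C x.2 y.2 : R)) (μ τ')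

/-- **Conjugation covariance**: `(g ⊗ g') K(μ) (g ⊗ g')ᵀ = K((Λ²g, Λ²g')·μ)`. [folklore] -/
private theorem conj_kMatR (g g' : Matrix (Fin 4) (Fin 4) R) (μ : Typ → R) :
    (g ⊗ₖ g') * kMatR μ * (g ⊗ₖ g')ᵀ = kMatR (actM (lam2 g) (lam2 g') μ) := by
  rw [kMatR_eq_sum μ, Finset.mul_sum, Finset.sum_mul]
  have h1 : ∀ τ : Typ, (g ⊗ₖ g') * (μ τ • (SA (R := R) τ.1 ⊗ₖ SA (R := R) τ.2)) * (g ⊗ₖ g')ᵀ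
      = μ τ • ((∑ A, lam2 g A τ.1 • SA (R := R) A) ⊗ₖ (∑ C, lam2 g' C τ.2 • SA (R := R) C)) := by
    intro τ
    rw [Matrix.mul_smul, Matrix.smul_mul, ← Matrix.kroneckerMap_transpose, ← Matrix.mul_kronecker_mul,
      ← Matrix.mul_kronecker_mul, conj_SA, conj_SA]
  simp_rw [h1]
  ext x y
  rw [kMatR_actM_apply]
  simp only [Matrix.sum_apply, Matrix.smul_apply, Matrix.kroneckerMap_apply, SA, smul_eq_mul]

/-- `det K((Λ²g, Λ²g')·μ) = (det g · det g')⁸ det K(μ)`. [folklore] -/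
private theorem det_kMatR_act (g g' : Matrix (Fin 4) (Fin 4) R) (μ : Typ → R) :
    (kMatR (actM (lam2 g) (lam2 g') μ)).det = (g.det * g'.det) ^ 8 * (kMatR μ).det := by
  rw [← conj_kMatR, Matrix.det_mul, Matrix.det_mul, Matrix.det_transpose, Matrix.det_kronecker,
    Fintype.card_fin]
  ring

/-! ### `Λ²` is multiplicative; the Hodge matrix `J`; `J Λ²g J (Λ²g)ᵀ = det g` -/

/-- `Λ²(1) = 1`. [folklore] -/
private theorem lam2_one : lam2 (1 : Matrix (Fin 4) (Fin 4) R) = 1 := by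
  ext A A'
  fin_cases A <;> fin_cases A' <;> simp [lam2, pairOf, Matrix.one_apply]

set_option maxHeartbeats 2000000 in
/-- `Λ²(gh) = Λ²g Λ²h` (Cauchy–Binet for `2 × 2` minors). [folklore] -/
private theorem lam2_mul (g h : Matrix (Fin 4) (Fin 4) R) : lam2 (g * h) = lam2 g * lam2 h := by
  ext A A'
  fin_cases A <;> fin_cases A' <;>
    simp [lam2, pairOf, Matrix.mul_apply, Fin.sum_univ_succ] <;> ring

/-- `Λ²(gᵀ) = (Λ²g)ᵀ`. [folklore] -/
private theorem lam2_transpose (g : Matrix (Fin 4) (Fin 4) R) : lam2 gᵀ = (lam2 g)ᵀ := by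
  ext A A'
  simp only [lam2, Matrix.transpose_apply]
  ring

/-- The (signed permutation) matrix of the Hodge star on `Λ²`: `J_{A A'} = sh(A) [A' = Aᶜ]`.
[folklore] -/
def Jst : Matrix (Fin 6) (Fin 6) R := fun A A' => if A' = complIdx A then (shSign A : R) else 0

/-- `J² = 1`. [folklore] -/
private theorem Jst_mul_Jst : (Jst : Matrix (Fin 6) (Fin 6) R) * Jst = 1 := by
  ext A A'
  fin_cases A <;> fin_cases A' <;>
    simp [Jst, Matrix.mul_apply, Fin.sum_univ_six, complIdx, shSign]

/-- The Leibniz expansion of a `4 × 4` determinant. [folklore] -/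
def det4 (g : Matrix (Fin 4) (Fin 4) R) : R :=
  g 0 0 * (g 1 1 * (g 2 2 * g 3 3 - g 2 3 * g 3 2) - g 1 2 * (g 2 1 * g 3 3 - g 2 3 * g 3 1)
      + g 1 3 * (g 2 1 * g 3 2 - g 2 2 * g 3 1))
  - g 0 1 * (g 1 0 * (g 2 2 * g 3 3 - g 2 3 * g 3 2) - g 1 2 * (g 2 0 * g 3 3 - g 2 3 * g 3 0)
      + g 1 3 * (g 2 0 * g 3 2 - g 2 2 * g 3 0))
  + g 0 2 * (g 1 0 * (g 2 1 * g 3 3 - g 2 3 * g 3 1) - g 1 1 * (g 2 0 * g 3 3 - g 2 3 * g 3 0)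
      + g 1 3 * (g 2 0 * g 3 1 - g 2 1 * g 3 0))
  - g 0 3 * (g 1 0 * (g 2 1 * g 3 2 - g 2 2 * g 3 1) - g 1 1 * (g 2 0 * g 3 2 - g 2 2 * g 3 0)
      + g 1 2 * (g 2 0 * g 3 1 - g 2 1 * g 3 0))

/-- `det g` equals its Leibniz expansion. [folklore] -/
private theorem det_eq_det4 (g : Matrix (Fin 4) (Fin 4) R) : g.det = det4 g := by
  rw [Matrix.det_succ_row_zero]
  simp [Fin.sum_univ_succ, Matrix.det_fin_three, Matrix.submatrix_apply, Fin.succAbove, det4]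
  ring

set_option maxHeartbeats 4000000 in
/-- **Laplace/Hodge identity**: `J Λ²g J (Λ²g)ᵀ = det g · 1`. [folklore] -/
private theorem Jst_lam2 (g : Matrix (Fin 4) (Fin 4) R) :
    Jst * lam2 g * Jst * (lam2 g)ᵀ = g.det • (1 : Matrix (Fin 6) (Fin 6) R) := by
  rw [det_eq_det4]
  ext A A'
  fin_cases A <;> fin_cases A' <;>
    simp [Jst, lam2, pairOf, complIdx, shSign, Matrix.mul_apply, Fin.sum_univ_succ,
      Matrix.smul_apply, det4] <;> ring

/-! ### Algebra of the action `actM` -/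

/-- `actM` is an action: composition. [folklore] -/
private theorem actM_actM (L L' M M' : Matrix (Fin 6) (Fin 6) R) (μ : Typ → R) :
    actM L L' (actM M M' μ) = actM (L * M) (L' * M') μ := by
  funext τ
  simp only [actM]
  simp only [Finset.mul_sum]
  rw [Finset.sum_comm]
  simp only [Matrix.mul_apply]
  refine Finset.sum_congr rfl fun τ'' _ => ?_
  have : ∀ x : Typ, L τ.1 x.1 * L' τ.2 x.2 * (M x.1 τ''.1 * M' x.2 τ''.2 * μ τ'') =
      L τ.1 x.1 * L' τ.2 x.2 * (M x.1 τ''.1 * M' x.2 τ''.2 * μ τ'') := fun _ => rfl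
  exact sum_pair_factor' (fun A => L τ.1 A) (fun C => L' τ.2 C) (fun A => M A τ''.1)
    (fun C => M' C τ''.2) (μ τ'')

/-- `actM 1 1 = id`. [folklore] -/
private theorem actM_one_one (μ : Typ → R) : actM (1 : Matrix (Fin 6) (Fin 6) R) 1 μ = μ := by
  funext τ
  simp only [actM]
  rw [Finset.sum_eq_single τ]
  · simp
  · intro τ' _ hne
    have : τ.1 ≠ τ'.1 ∨ τ.2 ≠ τ'.2 := by
      by_contra hcon
      push Not at hcon
      exact hne (Prod.ext hcon.1.symm hcon.2.symm)
    rcases this with h1 | h2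
    · simp [Matrix.one_apply, h1]
    · simp [Matrix.one_apply, h2]
  · intro h; exact absurd (Finset.mem_univ τ) h

/-- `actM` is additive in the first matrix. [folklore] -/
private theorem actM_add_left (L₁ L₂ L' : Matrix (Fin 6) (Fin 6) R) (μ : Typ → R) :
    actM (L₁ + L₂) L' μ = actM L₁ L' μ + actM L₂ L' μ := by
  funext τ
  simp only [actM, Matrix.add_apply, Pi.add_apply, add_mul, Finset.sum_add_distrib]

/-- `actM` is additive in the second matrix. [folklore] -/
private theorem actM_add_right (L L₁ L₂ : Matrix (Fin 6) (Fin 6) R) (μ : Typ → R) :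
    actM L (L₁ + L₂) μ = actM L L₁ μ + actM L L₂ μ := by
  funext τ
  simp only [actM, Matrix.add_apply, Pi.add_apply, add_mul, mul_add, Finset.sum_add_distrib]

/-- `actM` is additive in the vector. [folklore] -/
private theorem actM_add (L L' : Matrix (Fin 6) (Fin 6) R) (μ ν : Typ → R) :
    actM L L' (μ + ν) = actM L L' μ + actM L L' ν := by
  funext τ
  simp only [actM, Pi.add_apply, mul_add, Finset.sum_add_distrib]

/-- `actM` is homogeneous in the first matrix. [folklore] -/
private theorem actM_smul_left (c : R) (L L' : Matrix (Fin 6) (Fin 6) R) (μ : Typ → R) :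
    actM (c • L) L' μ = c • actM L L' μ := by
  funext τ
  simp only [actM, Matrix.smul_apply, Pi.smul_apply, smul_eq_mul, Finset.mul_sum]
  exact Finset.sum_congr rfl fun _ _ => by ring

/-- `actM` is homogeneous in the second matrix. [folklore] -/
private theorem actM_smul_right (c : R) (L L' : Matrix (Fin 6) (Fin 6) R) (μ : Typ → R) :
    actM L (c • L') μ = c • actM L L' μ := by
  funext τ
  simp only [actM, Matrix.smul_apply, Pi.smul_apply, smul_eq_mul, Finset.mul_sum]
  exact Finset.sum_congr rfl fun _ _ => by ring

/-- `actM` is homogeneous in the vector. [folklore] -/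
private theorem actM_smul (c : R) (L L' : Matrix (Fin 6) (Fin 6) R) (μ : Typ → R) :
    actM L L' (c • μ) = c • actM L L' μ := by
  funext τ
  simp only [actM, Pi.smul_apply, smul_eq_mul, Finset.mul_sum]
  exact Finset.sum_congr rfl fun _ _ => by ring

/-- `⋆⋆μ = (J, J)·μ`. [folklore] -/
private theorem starMuR_eq_actM (μ : Typ → R) : starMuR μ = actM Jst Jst μ := by
  funext τ
  simp only [actM, starMuR]
  rw [Finset.sum_eq_single (compl τ)]
  · simp [Jst, compl, sh2]
  · intro τ' _ hne
    have : τ'.1 ≠ complIdx τ.1 ∨ τ'.2 ≠ complIdx τ.2 := by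
      by_contra hcon
      push Not at hcon
      exact hne (Prod.ext hcon.1 hcon.2)
    rcases this with h1 | h2
    · simp [Jst, h1]
    · simp [Jst, h2]
  · intro h; exact absurd (Finset.mem_univ _) h

/-- `K(c μ) = c K(μ)`. [folklore] -/
private theorem kMatR_smul (c : R) (μ : Typ → R) : kMatR (c • μ) = c • kMatR μ := by
  ext x y
  simp only [kMatR, Pi.smul_apply, smul_eq_mul, Matrix.smul_apply, Finset.mul_sum]
  exact Finset.sum_congr rfl fun _ _ => by ring

/-- **Star covariance**: for invertible `g, g'`,
`det K(⋆⋆((Λ²g, Λ²g')·μ)) = (det g det g')⁸ det K(⋆⋆μ)`. [folklore] -/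
private theorem det_kMatR_star_act (g g' : Matrix (Fin 4) (Fin 4) R) (hg : IsUnit g.det)
    (hg' : IsUnit g'.det) (μ : Typ → R) :
    (kMatR (starMuR (actM (lam2 g) (lam2 g') μ))).det =
      (g.det * g'.det) ^ 8 * (kMatR (starMuR μ)).det := by
  -- inverses
  have hgi : g * g⁻¹ = 1 := Matrix.mul_nonsing_inv g hg
  have hig : g⁻¹ * g = 1 := Matrix.nonsing_inv_mul g hg
  have hgi' : g' * g'⁻¹ = 1 := Matrix.mul_nonsing_inv g' hg'
  have hig' : g'⁻¹ * g' = 1 := Matrix.nonsing_inv_mul g' hg'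
  -- `J Λ²g = det g • (Λ²(g⁻¹)ᵀ J)`
  have key : ∀ (k : Matrix (Fin 4) (Fin 4) R), k⁻¹ * k = 1 →
      (Jst : Matrix (Fin 6) (Fin 6) R) * lam2 k = k.det • (lam2 (k⁻¹)ᵀ * Jst) := by
    intro k hk
    have h1 : (lam2 k)ᵀ * (lam2 k⁻¹)ᵀ = 1 := by
      rw [← Matrix.transpose_mul, ← lam2_mul, hk, lam2_one, Matrix.transpose_one]
    have h2 : Jst * lam2 k * Jst = k.det • (lam2 k⁻¹)ᵀ := by
      have := congrArg (· * (lam2 k⁻¹)ᵀ) (Jst_lam2 k)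
      simpa only [Matrix.mul_assoc, h1, Matrix.mul_one, Matrix.smul_mul, Matrix.one_mul] using this
    have h3 := congrArg (· * (Jst : Matrix (Fin 6) (Fin 6) R)) h2
    simpa only [Matrix.mul_assoc, Jst_mul_Jst, Matrix.mul_one, Matrix.smul_mul, lam2_transpose] using h3
  have hdet : ∀ (k : Matrix (Fin 4) (Fin 4) R), k * k⁻¹ = 1 → k.det * (k⁻¹)ᵀ.det = 1 := by
    intro k hk
    rw [Matrix.det_transpose, ← Matrix.det_mul, hk, Matrix.det_one]
  rw [starMuR_eq_actM, starMuR_eq_actM, actM_actM, key g hig, key g' hig', actM_smul_left,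
    actM_smul_right, ← actM_actM, kMatR_smul, kMatR_smul, Matrix.det_smul, Matrix.det_smul,
    det_kMatR_act, Fintype.card_prod, Fintype.card_fin]
  have e1 := hdet g hgi
  have e2 := hdet g' hgi'
  calc g.det ^ (4 * 4) * (g'.det ^ (4 * 4) * (((g⁻¹)ᵀ.det * (g'⁻¹)ᵀ.det) ^ 8 *
        (kMatR (actM Jst Jst μ)).det))
      = (g.det * g'.det) ^ 8 * (g.det * (g⁻¹)ᵀ.det) ^ 8 * (g'.det * (g'⁻¹)ᵀ.det) ^ 8 *
        (kMatR (actM Jst Jst μ)).det := by ring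
    _ = (g.det * g'.det) ^ 8 * (kMatR (actM Jst Jst μ)).det := by rw [e1, e2]; ring

end Covariance

/-! ## Part B/C: vanishing on the slice and density of its orbit -/

section Generic

variable {A A' : Type*} [CommRing A] [CommRing A']

/-- `F(⋆⋆μ) - F(μ)` with `F = det K`. [folklore] -/
def FG (μ : Typ → A) : A := (kMatR (starMuR μ)).det - (kMatR μ).det

/-- Ring homomorphisms commute with `K(·)`. [folklore] -/
private theorem map_kMatR (f : A →+* A') (μ : Typ → A) : f.mapMatrix (kMatR μ) = kMatR (f ∘ μ) := by
  ext x y; simp [kMatR, map_sum]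

/-- Ring homomorphisms commute with `⋆⋆`. [folklore] -/
private theorem map_starMuR (f : A →+* A') (μ : Typ → A) : f ∘ starMuR μ = starMuR (f ∘ μ) := by
  funext τ; simp [starMuR]

/-- Ring homomorphisms commute with `Λ²`. [folklore] -/
private theorem map_lam2 (f : A →+* A') (g : Matrix (Fin 4) (Fin 4) A) :
    f.mapMatrix (lam2 g) = lam2 (f.mapMatrix g) := by
  ext a b; simp [lam2]

/-- Ring homomorphisms commute with `actM`. [folklore] -/
private theorem map_actM (f : A →+* A') (L L' : Matrix (Fin 6) (Fin 6) A) (μ : Typ → A) :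
    f ∘ actM L L' μ = actM (f.mapMatrix L) (f.mapMatrix L') (f ∘ μ) := by
  funext τ; simp [actM, map_sum]

/-- Ring homomorphisms commute with `F(⋆⋆·) - F`. [folklore] -/
private theorem map_FG (f : A →+* A') (μ : Typ → A) : f (FG μ) = FG (f ∘ μ) := by
  simp only [FG, map_sub, RingHom.map_det, map_kMatR, map_starMuR]

/-- `⋆⋆` is additive. [folklore] -/
private theorem starMuR_add (μ ν : Typ → A) : starMuR (μ + ν) = starMuR μ + starMuR ν := by
  funext τ; simp [starMuR, mul_add]

/-- `⋆⋆` is homogeneous. [folklore] -/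
private theorem starMuR_smul (c : A) (μ : Typ → A) : starMuR (c • μ) = c • starMuR μ := by
  funext τ; simp only [starMuR, Pi.smul_apply, smul_eq_mul]; ring

/-- `⋆⋆` is an involution. [folklore] -/
private theorem starMuR_starMuR (μ : Typ → A) : starMuR (starMuR μ) = μ := by
  rw [starMuR_eq_actM, starMuR_eq_actM, actM_actM, Jst_mul_Jst, actM_one_one]

/-- `F(⋆⋆·) - F` vanishes on the `GL₄ × GL₄`-orbit of the `⋆⋆`-fixed slice. [folklore] -/
private theorem FG_act_eq_zero (g g' : Matrix (Fin 4) (Fin 4) A) (hg : IsUnit g.det) (hg' : IsUnit g'.det)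
    (s : Typ → A) (hs : starMuR s = s) : FG (actM (lam2 g) (lam2 g') s) = 0 := by
  simp only [FG, det_kMatR_star_act g g' hg hg', det_kMatR_act, hs, sub_self]

/-- Off-diagonal block values of the base point `s₀` of the slice. [folklore] -/
def yv : Fin 6 → ℤ := ![1, -2, 1, 1, -2, 1]

/-- The base point `s₀ ∈ 𝔰` (identity plus `y_A E_{A Aᶜ}`). [folklore] -/
def s0 : Typ → ℤ := fun τ => if τ.2 = τ.1 then 1 else if τ.2 = complIdx τ.1 then yv τ.1 else 0

set_option maxRecDepth 100000 in
/-- `s₀` is `⋆⋆`-fixed. [folklore] -/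
private theorem starMu_s0 : starMu s0 = s0 := by decide +kernel

variable (A) in
/-- `s₀` in a ring. [folklore] -/
def s0A : Typ → A := fun τ => (s0 τ : A)

/-- `s₀` is `⋆⋆`-fixed (in any ring). [folklore] -/
private theorem starMuR_s0A : starMuR (s0A A) = s0A A := by
  funext τ
  have h := congrFun starMu_s0 τ
  simp only [starMu] at h
  simp only [starMuR, s0A, ← Int.cast_mul, h]

/-- Ring homomorphisms fix `s₀`. [folklore] -/
private theorem map_s0A (f : A →+* A') : f ∘ s0A A = s0A A' := by
  funext τ; simp [s0A]

/-- The slice parametrisation `ν ↦ s₀ + ν + ⋆⋆ν`. [folklore] -/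
def sl (ν : Typ → A) : Typ → A := s0A A + ν + starMuR ν

/-- The slice is `⋆⋆`-fixed. [folklore] -/
private theorem starMuR_sl (ν : Typ → A) : starMuR (sl ν) = sl ν := by
  simp only [sl, starMuR_add, starMuR_starMuR, starMuR_s0A]
  abel

/-- Ring homomorphisms commute with the slice parametrisation. [folklore] -/
private theorem map_sl (f : A →+* A') (ν : Typ → A) : f ∘ sl ν = sl (f ∘ ν) := by
  funext τ; simp [sl, s0A, starMuR]

/-- The derivative of `Λ²` at the identity: `Λ²(1 + cY) = 1 + c D(Y) + c² Λ²(Y)`. [folklore] -/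
def Dh (Y : Matrix (Fin 4) (Fin 4) A) : Matrix (Fin 6) (Fin 6) A := fun a b =>
  (if (pairOf a).1 = (pairOf b).1 then Y (pairOf a).2 (pairOf b).2 else 0)
  + (if (pairOf a).2 = (pairOf b).2 then Y (pairOf a).1 (pairOf b).1 else 0)
  - (if (pairOf a).1 = (pairOf b).2 then Y (pairOf a).2 (pairOf b).1 else 0)
  - (if (pairOf a).2 = (pairOf b).1 then Y (pairOf a).1 (pairOf b).2 else 0)

set_option maxHeartbeats 2000000 in
/-- Helper `lam2_one_add_smul`. [folklore] -/
private theorem lam2_one_add_smul (c : A) (Y : Matrix (Fin 4) (Fin 4) A) :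
    lam2 (1 + c • Y) = 1 + c • Dh Y + c ^ 2 • lam2 Y := by
  ext a b
  fin_cases a <;> fin_cases b <;> simp [lam2, Dh, pairOf] <;> ring

/-- Ring homomorphisms commute with `D`. [folklore] -/
private theorem map_Dh (f : A →+* A') (Y : Matrix (Fin 4) (Fin 4) A) :
    f.mapMatrix (Dh Y) = Dh (f.mapMatrix Y) := by
  ext a b
  simp only [RingHom.mapMatrix_apply, Matrix.map_apply, Dh, map_add, map_sub]
  split_ifs <;> simp

/-- First-order expansion of `actM` around the identity. [folklore] -/
private theorem actM_expand (c : A) (P₁ P₂ : Matrix (Fin 6) (Fin 6) A) (m₀ m₁ : Typ → A) :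
    actM (1 + c • P₁) (1 + c • P₂) (m₀ + c • m₁) =
      m₀ + c • (actM P₁ 1 m₀ + actM 1 P₂ m₀ + m₁
        + c • (actM P₁ P₂ m₀ + actM P₁ 1 m₁ + actM 1 P₂ m₁) + c ^ 2 • actM P₁ P₂ m₁) := by
  simp only [actM_add_left, actM_add_right, actM_add, actM_smul_left, actM_smul_right, actM_smul,
    actM_one_one]
  funext τ
  simp only [Pi.add_apply, Pi.smul_apply, smul_eq_mul]
  ring

/-- `(L, 1)·μ` entrywise. [folklore] -/
private theorem actM_one_right_apply (L : Matrix (Fin 6) (Fin 6) A) (μ : Typ → A) (a b : Fin 6) :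
    actM L 1 μ (a, b) = ∑ a', L a a' * μ (a', b) := by
  simp only [actM, Fintype.sum_prod_type]
  refine Finset.sum_congr rfl fun a' _ => ?_
  rw [Finset.sum_eq_single b]
  · simp
  · intro b' _ hne
    simp [Ne.symm hne]
  · intro h; exact absurd (Finset.mem_univ b) h

/-- `(1, L')·μ` entrywise. [folklore] -/
private theorem actM_one_left_apply (L' : Matrix (Fin 6) (Fin 6) A) (μ : Typ → A) (a b : Fin 6) :
    actM 1 L' μ (a, b) = ∑ b', L' b b' * μ (a, b') := by
  simp only [actM, Fintype.sum_prod_type]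
  rw [Finset.sum_eq_single a]
  · simp
  · intro a' _ hne
    simp [Ne.symm hne]
  · intro h; exact absurd (Finset.mem_univ a) h

end Generic

/-! ### The orbit map as a polynomial map and the vanishing of `F(⋆⋆·) - F` along it -/

section Orbit

/-- Parameters of the orbit map: `X, X' ∈ M₄` and `ν ∈ M₆`. [folklore] -/
abbrev U := (Fin 4 × Fin 4) ⊕ ((Fin 4 × Fin 4) ⊕ Typ)

/-- The coordinate ring of the parameter space. [folklore] -/
abbrev B := MvPolynomial U ℚ

/-- The generic matrix `X`. [folklore] -/
noncomputable def Xh : Matrix (Fin 4) (Fin 4) B := fun i j => X (Sum.inl (i, j))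

/-- The generic matrix `X'`. [folklore] -/
noncomputable def Xh' : Matrix (Fin 4) (Fin 4) B := fun i j => X (Sum.inr (Sum.inl (i, j)))

/-- The generic slice coordinates `ν`. [folklore] -/
noncomputable def νh : Typ → B := fun τ => X (Sum.inr (Sum.inr τ))

/-- The orbit map `Φ(X, X', ν) = (Λ²(1+X), Λ²(1+X'))·(s₀ + ν + ⋆⋆ν)`. [folklore] -/
noncomputable def Φh : Typ → B := actM (lam2 (1 + Xh)) (lam2 (1 + Xh')) (sl νh)

/-- `det(1+X) det(1+X')`. [folklore] -/
noncomputable def Dpoly : B := (1 + Xh).det * (1 + Xh').det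

/-- `det(1+X) det(1+X') · (F(⋆⋆Φ) - F(Φ)) = 0` pointwise. [folklore] -/
private theorem eval_Dpoly_mul_FG_Φh (u : U → ℚ) : eval u Dpoly * eval u (FG Φh) = 0 := by
  have hΦ : (eval u) ∘ Φh = actM (lam2 (1 + (eval u).mapMatrix Xh))
      (lam2 (1 + (eval u).mapMatrix Xh')) (sl ((eval u) ∘ νh)) := by
    simp only [Φh, map_actM, map_lam2, map_add, map_one, map_sl]
  have hD : eval u Dpoly = (1 + (eval u).mapMatrix Xh).det * (1 + (eval u).mapMatrix Xh').det := by
    simp only [Dpoly, map_mul, RingHom.map_det, map_add, map_one]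
  by_cases h : eval u Dpoly = 0
  · rw [h, zero_mul]
  · rw [hD] at h
    have h1 : IsUnit (1 + (eval u).mapMatrix Xh).det := isUnit_iff_ne_zero.mpr (left_ne_zero_of_mul h)
    have h2 : IsUnit (1 + (eval u).mapMatrix Xh').det :=
      isUnit_iff_ne_zero.mpr (right_ne_zero_of_mul h)
    rw [map_FG, hΦ, FG_act_eq_zero _ _ h1 h2 _ (starMuR_sl _), mul_zero]

/-- `F(⋆⋆Φ) = F(Φ)` identically in the parameters. [folklore] -/
private theorem FG_Φh : FG Φh = 0 := by
  have h1 : Dpoly * FG Φh = 0 := by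
    apply MvPolynomial.funext
    intro u
    rw [map_mul, map_zero]
    exact eval_Dpoly_mul_FG_Φh u
  have h2 : Dpoly ≠ 0 := by
    intro h
    have h0 := congrArg (eval (0 : U → ℚ)) h
    have hX : (eval (0 : U → ℚ)).mapMatrix Xh = 0 := by ext i j; simp [Xh]
    have hX' : (eval (0 : U → ℚ)).mapMatrix Xh' = 0 := by ext i j; simp [Xh']
    simp only [Dpoly, map_mul, RingHom.map_det, map_add, map_one, hX, hX', add_zero, Matrix.det_one,
      mul_one, map_zero] at h0
    exact one_ne_zero h0
  exact (mul_eq_zero.mp h1).resolve_left h2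

end Orbit

/-! ### The `ε`-dilation and the linearised orbit map -/

section Dilation

/-- `B[ε]`. [folklore] -/
abbrev Bε := Polynomial B

/-- The dilation `u ↦ ε u` of the parameters: `X_i ↦ ε X_i`. [folklore] -/
noncomputable def dil : B →+* Bε :=
  MvPolynomial.eval₂Hom (Polynomial.C.comp MvPolynomial.C) (fun i => (Polynomial.X : Bε) * Polynomial.C (X i))

/-- The dilation on variables. [folklore] -/
private theorem dil_X (i : U) : dil (X i) = (Polynomial.X : Bε) * Polynomial.C (X i) := by
  simp [dil]

/-- `X` with constant (`ε`-free) entries in `B[ε]`. [folklore] -/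
noncomputable def Xc : Matrix (Fin 4) (Fin 4) Bε := fun i j => Polynomial.C (Xh i j)
/-- `X'` with constant entries in `B[ε]`. [folklore] -/
noncomputable def Xc' : Matrix (Fin 4) (Fin 4) Bε := fun i j => Polynomial.C (Xh' i j)
/-- `ν` with constant entries in `B[ε]`. [folklore] -/
noncomputable def νc : Typ → Bε := fun τ => Polynomial.C (νh τ)
/-- `(Λ²(1 + εX) - 1)/ε`. [folklore] -/
noncomputable def P₁ : Matrix (Fin 6) (Fin 6) Bε := Dh Xc + (Polynomial.X : Bε) • lam2 Xc
/-- `(Λ²(1 + εX') - 1)/ε`. [folklore] -/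
noncomputable def P₂ : Matrix (Fin 6) (Fin 6) Bε := Dh Xc' + (Polynomial.X : Bε) • lam2 Xc'
/-- `ν + ⋆⋆ν` in `B[ε]`. [folklore] -/
noncomputable def m₁ : Typ → Bε := νc + starMuR νc

/-- `(Φ(εu) - s₀)/ε`. [folklore] -/
noncomputable def ψ : Typ → Bε :=
  actM P₁ 1 (s0A Bε) + actM 1 P₂ (s0A Bε) + m₁
    + (Polynomial.X : Bε) • (actM P₁ P₂ (s0A Bε) + actM P₁ 1 m₁ + actM 1 P₂ m₁)
    + (Polynomial.X : Bε) ^ 2 • actM P₁ P₂ m₁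

/-- The linearised orbit map `L(X, X', ν) = D(X) s₀ + s₀ D(X')ᵀ + ν + ⋆⋆ν`. [folklore] -/
noncomputable def Lh : Typ → B := actM (Dh Xh) 1 (s0A B) + actM 1 (Dh Xh') (s0A B) + (νh + starMuR νh)

/-- The dilation on `X`. [folklore] -/
private theorem dil_Xh : dil.mapMatrix Xh = (Polynomial.X : Bε) • Xc := by
  ext i j; simp [Xh, Xc, dil_X]

/-- The dilation on `X'`. [folklore] -/
private theorem dil_Xh' : dil.mapMatrix Xh' = (Polynomial.X : Bε) • Xc' := by
  ext i j; simp [Xh', Xc', dil_X]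

/-- The dilation on `ν`. [folklore] -/
private theorem dil_νh : dil ∘ νh = (Polynomial.X : Bε) • νc := by
  funext τ; simp [νh, νc, dil_X]

/-- The dilation on the slice. [folklore] -/
private theorem dil_sl : dil ∘ sl νh = s0A Bε + (Polynomial.X : Bε) • m₁ := by
  rw [map_sl, dil_νh, sl, m₁, starMuR_smul, smul_add, add_assoc]

/-- `Φ(εu) = s₀ + ε ψ`. [folklore] -/
private theorem dil_Φh : dil ∘ Φh = s0A Bε + (Polynomial.X : Bε) • ψ := by
  rw [Φh, map_actM, map_lam2, map_lam2, map_add, map_one, map_add, map_one, dil_Xh, dil_Xh', dil_sl,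
    lam2_one_add_smul, lam2_one_add_smul]
  have e1 : (1 : Matrix (Fin 6) (Fin 6) Bε) + (Polynomial.X : Bε) • Dh Xc
      + (Polynomial.X : Bε) ^ 2 • lam2 Xc = 1 + (Polynomial.X : Bε) • P₁ := by
    rw [P₁, smul_add, smul_smul, ← pow_two, add_assoc]
  have e2 : (1 : Matrix (Fin 6) (Fin 6) Bε) + (Polynomial.X : Bε) • Dh Xc'
      + (Polynomial.X : Bε) ^ 2 • lam2 Xc' = 1 + (Polynomial.X : Bε) • P₂ := by
    rw [P₂, smul_add, smul_smul, ← pow_two, add_assoc]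
  rw [e1, e2, actM_expand]
  rfl

/-- `ψ|_{ε = 0}` is the linearised orbit map. [folklore] -/
private theorem eval0_ψ : (fun τ => (ψ τ).eval 0) = Lh := by
  set ev : Bε →+* B := Polynomial.evalRingHom 0 with hev
  have hXc : ev.mapMatrix Xc = Xh := by ext i j; simp [hev, Xc]
  have hXc' : ev.mapMatrix Xc' = Xh' := by ext i j; simp [hev, Xc']
  have hP₁ : ev.mapMatrix P₁ = Dh Xh := by
    rw [P₁, map_add, map_Dh, hXc]
    have : ev.mapMatrix ((Polynomial.X : Bε) • lam2 Xc) = 0 := by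
      ext a b; simp [hev]
    rw [this, add_zero]
  have hP₂ : ev.mapMatrix P₂ = Dh Xh' := by
    rw [P₂, map_add, map_Dh, hXc']
    have : ev.mapMatrix ((Polynomial.X : Bε) • lam2 Xc') = 0 := by
      ext a b; simp [hev]
    rw [this, add_zero]
  have hm₀ : ev ∘ s0A Bε = s0A B := map_s0A ev
  have hm₁ : ev ∘ m₁ = νh + starMuR νh := by
    funext τ; simp [hev, m₁, νc, starMuR]
  have h1 : ev ∘ actM P₁ 1 (s0A Bε) = actM (Dh Xh) 1 (s0A B) := by
    rw [map_actM, hP₁, map_one, hm₀]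
  have h2 : ev ∘ actM 1 P₂ (s0A Bε) = actM 1 (Dh Xh') (s0A B) := by
    rw [map_actM, hP₂, map_one, hm₀]
  funext τ
  have h1' := congrFun h1 τ
  have h2' := congrFun h2 τ
  have hm₁' := congrFun hm₁ τ
  simp only [Function.comp_apply] at h1' h2' hm₁'
  have hX0 : ev Polynomial.X = 0 := by simp [hev]
  show ev (ψ τ) = Lh τ
  simp only [ψ, Lh, Pi.add_apply, Pi.smul_apply, smul_eq_mul, map_add, map_mul, map_pow, hX0,
    zero_mul, add_zero, h1', h2', hm₁']
  ring

end Dilation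

/-! ### The lowest-order argument -/

section LowestOrder

variable {σ : Type*} {B' : Type*} [CommRing B'] [Algebra ℚ B']

/-- Homogeneous components scale: `Q_n(c f) = cⁿ Q_n(f)`. [folklore] -/
private theorem aeval_mul_homogeneousComponent (Q : MvPolynomial σ ℚ) (n : ℕ) (c : B') (f : σ → B') :
    aeval (fun i => c * f i) (homogeneousComponent n Q) =
      c ^ n * aeval f (homogeneousComponent n Q) := by
  classical
  rw [homogeneousComponent_apply, map_sum, map_sum, Finset.mul_sum]
  refine Finset.sum_congr rfl fun d hd => ?_
  rw [Finset.mem_filter] at hd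
  rw [aeval_monomial, aeval_monomial]
  have : (d.prod fun i k => (c * f i) ^ k) = c ^ n * d.prod fun i k => f i ^ k := by
    simp only [mul_pow]
    rw [Finsupp.prod_mul]
    congr 1
    rw [Finsupp.prod, Finset.prod_pow_eq_pow_sum, ← Finsupp.degree_apply, hd.2]
  rw [this]
  ring

/-- Evaluation at `ε = 0` commutes with `aeval`. [folklore] -/
private theorem eval_zero_aeval (ψ' : σ → Polynomial B') (q : MvPolynomial σ ℚ) :
    (aeval ψ' q).eval 0 = aeval (fun i => (ψ' i).eval 0) q := by
  rw [← Polynomial.coe_evalRingHom, map_aeval, aeval_eq_eval₂Hom]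
  have : (Polynomial.evalRingHom 0).comp (algebraMap ℚ (Polynomial B')) = algebraMap ℚ B' :=
    Subsingleton.elim _ _
  rw [this]

/-- **Lowest-order lemma**: if `Q(ε ψ) = 0` and `Q` has no terms of degree `< d`, then
`Q_d(ψ|_{ε=0}) = 0`. [folklore] -/
private theorem lowest_order (Q : MvPolynomial σ ℚ) (ψ' : σ → Polynomial B') (d : ℕ)
    (hlow : ∀ n < d, homogeneousComponent n Q = 0)
    (h0 : aeval (fun i => (Polynomial.X : Polynomial B') * ψ' i) Q = 0) :
    aeval (fun i => (ψ' i).eval 0) (homogeneousComponent d Q) = 0 := by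
  classical
  have hsum : ∑ n ∈ Finset.range (Q.totalDegree + 1),
      (Polynomial.X : Polynomial B') ^ n * aeval ψ' (homogeneousComponent n Q) = 0 := by
    have h := h0
    conv_lhs at h => rw [← sum_homogeneousComponent Q]
    rw [map_sum] at h
    simpa only [aeval_mul_homogeneousComponent] using h
  have hc := congrArg (fun p : Polynomial B' => p.coeff d) hsum
  simp only [Polynomial.finsetSum_coeff, Polynomial.coeff_X_pow_mul', Polynomial.coeff_zero] at hc
  rw [Finset.sum_eq_single d] at hc
  · simp only [le_refl, if_true, Nat.sub_self, Polynomial.coeff_zero_eq_eval_zero, eval_zero_aeval] at hc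
    exact hc
  · intro n _ hne
    by_cases hnd : n ≤ d
    · have hlt : n < d := lt_of_le_of_ne hnd hne
      simp [hlow n hlt]
    · simp [hnd]
  · intro hd
    have hlt : Q.totalDegree < d := by
      simpa [Finset.mem_range, Nat.lt_succ_iff] using hd
    simp [homogeneousComponent_eq_zero (h := hlt)]

end LowestOrder

/-! ### The certificate: an explicit right inverse of the linearised orbit map -/

section Certificate

/-- Coordinate `μ_{a c}` as a polynomial variable. [folklore] -/
noncomputable def x (a c : Fin 6) : MvPolynomial Typ ℚ := X (a, c)

/-- Certificate table (scaled by `24`): images of the `X`-parameters under a right inverse of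
the linearised orbit map. [folklore] -/
noncomputable def rX : Fin 4 → Fin 4 → MvPolynomial Typ ℚ :=
  ![![6 * x 0 0 + 6 * x 0 5 + 6 * x 1 1 - 3 * x 1 4 + 3 * x 4 1 - 6 * x 4 4 - 6 * x 5 0 - 6 * x 5 5,
    8 * x 1 2 + 8 * x 1 3 + 8 * x 2 4 + 8 * x 3 1 + 8 * x 4 2 + 8 * x 4 3,
    -6 * x 0 2 - 6 * x 0 3 + 6 * x 2 0 + 6 * x 2 5 - 6 * x 3 0 - 6 * x 3 5 + 6 * x 5 2 + 6 * x 5 3,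
    -8 * x 0 4 - 8 * x 1 0 - 8 * x 1 5 - 8 * x 4 0 - 8 * x 4 5 - 8 * x 5 1],
  ![0,
    6 * x 0 0 + 6 * x 0 5 - 6 * x 2 2 - 6 * x 2 3 + 6 * x 3 2 + 6 * x 3 3 - 6 * x 5 0 - 6 * x 5 5,
    8 * x 0 1 + 8 * x 1 0 + 8 * x 1 5 + 8 * x 4 0 + 8 * x 4 5 + 8 * x 5 4,
    6 * x 0 2 + 6 * x 0 3 + 6 * x 2 0 + 6 * x 2 5 - 6 * x 3 0 - 6 * x 3 5 - 6 * x 5 2 - 6 * x 5 3],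
  ![0,
    0,
    6 * x 1 1 - 3 * x 1 4 - 6 * x 2 2 - 6 * x 2 3 + 6 * x 3 2 + 6 * x 3 3 + 3 * x 4 1 - 6 * x 4 4,
    8 * x 1 2 + 8 * x 1 3 + 8 * x 2 1 + 8 * x 3 4 + 8 * x 4 2 + 8 * x 4 3],
  ![0,
    0,
    0,
    0]]

/-- Certificate table (scaled by `24`): images of the `X'`-parameters. [folklore] -/
noncomputable def rX' : Fin 4 → Fin 4 → MvPolynomial Typ ℚ :=
  ![![6 * x 0 0 - 6 * x 0 5 + 6 * x 1 1 + 3 * x 1 4 - 3 * x 4 1 - 6 * x 4 4 + 6 * x 5 0 - 6 * x 5 5,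
    8 * x 1 3 + 8 * x 2 1 + 8 * x 2 4 + 8 * x 3 1 + 8 * x 3 4 + 8 * x 4 2,
    6 * x 0 2 - 6 * x 0 3 - 6 * x 2 0 + 6 * x 2 5 - 6 * x 3 0 + 6 * x 3 5 + 6 * x 5 2 - 6 * x 5 3,
    -8 * x 0 1 - 8 * x 0 4 - 8 * x 1 5 - 8 * x 4 0 - 8 * x 5 1 - 8 * x 5 4],
  ![0,
    6 * x 0 0 - 6 * x 0 5 - 6 * x 2 2 + 6 * x 2 3 - 6 * x 3 2 + 6 * x 3 3 + 6 * x 5 0 - 6 * x 5 5,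
    8 * x 0 1 + 8 * x 0 4 + 8 * x 1 0 + 8 * x 4 5 + 8 * x 5 1 + 8 * x 5 4,
    6 * x 0 2 - 6 * x 0 3 + 6 * x 2 0 - 6 * x 2 5 + 6 * x 3 0 - 6 * x 3 5 + 6 * x 5 2 - 6 * x 5 3],
  ![0,
    0,
    6 * x 1 1 + 3 * x 1 4 - 6 * x 2 2 + 6 * x 2 3 - 6 * x 3 2 + 6 * x 3 3 - 3 * x 4 1 - 6 * x 4 4,
    8 * x 1 2 + 8 * x 2 1 + 8 * x 2 4 + 8 * x 3 1 + 8 * x 3 4 + 8 * x 4 3],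
  ![0,
    0,
    0,
    0]]

/-- Certificate table (scaled by `24`): images of the `ν`-parameters. [folklore] -/
noncomputable def rν : Fin 6 → Fin 6 → MvPolynomial Typ ℚ :=
  ![![-12 * x 1 1 + 12 * x 2 2 - 12 * x 3 3 + 12 * x 4 4 + 24 * x 5 5,
    8 * x 0 1 + 8 * x 0 4 + 8 * x 1 0 + 8 * x 4 5 + 8 * x 5 1 - 16 * x 5 4,
    6 * x 0 2 - 6 * x 0 3 + 6 * x 2 0 - 6 * x 2 5 + 6 * x 3 0 - 6 * x 3 5 + 6 * x 5 2 + 18 * x 5 3,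
    -6 * x 0 2 + 6 * x 0 3 + 6 * x 2 0 - 6 * x 2 5 + 6 * x 3 0 - 6 * x 3 5 + 18 * x 5 2 + 6 * x 5 3,
    8 * x 0 1 + 8 * x 0 4 + 8 * x 1 5 + 8 * x 4 0 - 16 * x 5 1 + 8 * x 5 4,
    -12 * x 0 0 + 12 * x 0 5 - 12 * x 1 1 + 12 * x 2 2 - 12 * x 3 3 + 12 * x 4 4 + 12 * x 5 0 + 12 * x 5 5],
  ![8 * x 0 1 + 8 * x 1 0 + 8 * x 1 5 + 8 * x 4 0 - 16 * x 4 5 + 8 * x 5 4,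
    -12 * x 0 0 + 12 * x 2 2 - 12 * x 3 3 + 24 * x 4 4 + 12 * x 5 5,
    8 * x 1 2 + 8 * x 2 1 + 8 * x 2 4 + 8 * x 3 1 + 8 * x 3 4 - 16 * x 4 3,
    8 * x 1 3 + 8 * x 2 1 + 8 * x 2 4 + 8 * x 3 1 + 8 * x 3 4 - 16 * x 4 2,
    24 * x 0 0 + 24 * x 1 1 + 12 * x 1 4 - 24 * x 2 2 + 24 * x 3 3 + 12 * x 4 1 - 24 * x 4 4 - 24 * x 5 5,
    -8 * x 0 4 - 8 * x 1 0 + 16 * x 1 5 - 8 * x 4 0 - 8 * x 4 5 - 8 * x 5 1],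
  ![6 * x 0 2 + 6 * x 0 3 + 6 * x 2 0 + 6 * x 2 5 - 6 * x 3 0 + 18 * x 3 5 - 6 * x 5 2 - 6 * x 5 3,
    8 * x 1 2 + 8 * x 1 3 + 8 * x 2 1 - 16 * x 3 4 + 8 * x 4 2 + 8 * x 4 3,
    -12 * x 0 0 - 12 * x 1 1 + 24 * x 2 2 + 12 * x 4 4 + 12 * x 5 5,
    -12 * x 0 0 - 12 * x 1 1 + 12 * x 2 2 + 12 * x 2 3 + 12 * x 3 2 - 12 * x 3 3 + 12 * x 4 4 + 12 * x 5 5,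
    -8 * x 1 2 - 8 * x 1 3 + 16 * x 2 4 - 8 * x 3 1 - 8 * x 4 2 - 8 * x 4 3,
    6 * x 0 2 + 6 * x 0 3 - 6 * x 2 0 + 18 * x 2 5 + 6 * x 3 0 + 6 * x 3 5 - 6 * x 5 2 - 6 * x 5 3],
  ![0,
    0,
    0,
    0,
    0,
    0],
  ![0,
    0,
    0,
    0,
    0,
    0],
  ![0,
    0,
    0,
    0,
    0,
    0]]

/-- The certificate substitution `r : u ↦ linear form in μ`. [folklore] -/
noncomputable def r : U → MvPolynomial Typ ℚ
  | Sum.inl p => rX p.1 p.2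
  | Sum.inr (Sum.inl p) => rX' p.1 p.2
  | Sum.inr (Sum.inr τ) => rν τ.1 τ.2

/-- `r(X)` as a matrix. [folklore] -/
noncomputable def RXm : Matrix (Fin 4) (Fin 4) (MvPolynomial Typ ℚ) := fun i j => rX i j
/-- `r(X')` as a matrix. [folklore] -/
noncomputable def RXm' : Matrix (Fin 4) (Fin 4) (MvPolynomial Typ ℚ) := fun i j => rX' i j
/-- `r(ν)` as a coefficient vector. [folklore] -/
noncomputable def rνf : Typ → MvPolynomial Typ ℚ := fun τ => rν τ.1 τ.2

/-- `r` applied to the linearised orbit map. [folklore] -/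
noncomputable def LC : Typ → MvPolynomial Typ ℚ :=
  actM (Dh RXm) 1 (s0A _) + actM 1 (Dh RXm') (s0A _) + (rνf + starMuR rνf)

/-- The certificate substitution applied to the linearised orbit map. [folklore] -/
private theorem bind_r_Lh : (fun τ => bind₁ r (Lh τ)) = LC := by
  set f : B →+* MvPolynomial Typ ℚ := (bind₁ r).toRingHom with hf
  have hfX : f.mapMatrix Xh = RXm := by ext i j; simp [hf, Xh, RXm, r]
  have hfX' : f.mapMatrix Xh' = RXm' := by ext i j; simp [hf, Xh', RXm', r]
  have hfν : f ∘ νh = rνf := by funext τ; simp [hf, νh, rνf, r]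
  have hm₀ : f ∘ s0A B = s0A (MvPolynomial Typ ℚ) := map_s0A f
  have h1 : f ∘ actM (Dh Xh) 1 (s0A B) = actM (Dh RXm) 1 (s0A _) := by
    rw [map_actM, map_Dh, hfX, map_one, hm₀]
  have h2 : f ∘ actM 1 (Dh Xh') (s0A B) = actM 1 (Dh RXm') (s0A _) := by
    rw [map_actM, map_Dh, hfX', map_one, hm₀]
  have h3 : f ∘ (νh + starMuR νh) = rνf + starMuR rνf := by
    have := map_starMuR f νh
    rw [hfν] at this
    funext τ
    have t1 := congrFun this τ
    have t2 := congrFun hfν τ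
    simp only [Function.comp_apply] at t1 t2
    simp only [Function.comp_apply, Pi.add_apply, map_add, t1, t2]
  funext τ
  have h1' := congrFun h1 τ
  have h2' := congrFun h2 τ
  have h3' := congrFun h3 τ
  simp only [Function.comp_apply] at h1' h2' h3'
  simp only [Pi.add_apply, map_add] at h3'
  show f (Lh τ) = LC τ
  simp only [Lh, LC, Pi.add_apply, map_add, h1', h2', h3']

set_option maxHeartbeats 4000000 in
/-- Certificate check at coordinate `(0, 0)`. [folklore] -/
private theorem cert_0_0 : LC ((0 : Fin 6), (0 : Fin 6)) = 24 * x 0 0 := by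
  simp [LC, actM_one_right_apply, actM_one_left_apply, Dh, RXm, RXm', rνf, rX, rX', rν, pairOf,
    complIdx, shSign, sh2, compl, s0, s0A, yv, starMuR, Fin.sum_univ_six]
  ring

set_option maxHeartbeats 4000000 in
/-- Certificate check at coordinate `(0, 1)`. [folklore] -/
private theorem cert_0_1 : LC ((0 : Fin 6), (1 : Fin 6)) = 24 * x 0 1 := by
  simp [LC, actM_one_right_apply, actM_one_left_apply, Dh, RXm, RXm', rνf, rX, rX', rν, pairOf,
    complIdx, shSign, sh2, compl, s0, s0A, yv, starMuR, Fin.sum_univ_six]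
  ring

set_option maxHeartbeats 4000000 in
/-- Certificate check at coordinate `(0, 2)`. [folklore] -/
private theorem cert_0_2 : LC ((0 : Fin 6), (2 : Fin 6)) = 24 * x 0 2 := by
  simp [LC, actM_one_right_apply, actM_one_left_apply, Dh, RXm, RXm', rνf, rX, rX', rν, pairOf,
    complIdx, shSign, sh2, compl, s0, s0A, yv, starMuR, Fin.sum_univ_six]
  ring

set_option maxHeartbeats 4000000 in
/-- Certificate check at coordinate `(0, 3)`. [folklore] -/
private theorem cert_0_3 : LC ((0 : Fin 6), (3 : Fin 6)) = 24 * x 0 3 := by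
  simp [LC, actM_one_right_apply, actM_one_left_apply, Dh, RXm, RXm', rνf, rX, rX', rν, pairOf,
    complIdx, shSign, sh2, compl, s0, s0A, yv, starMuR, Fin.sum_univ_six]
  ring

set_option maxHeartbeats 4000000 in
/-- Certificate check at coordinate `(0, 4)`. [folklore] -/
private theorem cert_0_4 : LC ((0 : Fin 6), (4 : Fin 6)) = 24 * x 0 4 := by
  simp [LC, actM_one_right_apply, actM_one_left_apply, Dh, RXm, RXm', rνf, rX, rX', rν, pairOf,
    complIdx, shSign, sh2, compl, s0, s0A, yv, starMuR, Fin.sum_univ_six]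
  ring

set_option maxHeartbeats 4000000 in
/-- Certificate check at coordinate `(0, 5)`. [folklore] -/
private theorem cert_0_5 : LC ((0 : Fin 6), (5 : Fin 6)) = 24 * x 0 5 := by
  simp [LC, actM_one_right_apply, actM_one_left_apply, Dh, RXm, RXm', rνf, rX, rX', rν, pairOf,
    complIdx, shSign, sh2, compl, s0, s0A, yv, starMuR, Fin.sum_univ_six]
  ring

set_option maxHeartbeats 4000000 in
/-- Certificate check at coordinate `(1, 0)`. [folklore] -/
private theorem cert_1_0 : LC ((1 : Fin 6), (0 : Fin 6)) = 24 * x 1 0 := by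
  simp [LC, actM_one_right_apply, actM_one_left_apply, Dh, RXm, RXm', rνf, rX, rX', rν, pairOf,
    complIdx, shSign, sh2, compl, s0, s0A, yv, starMuR, Fin.sum_univ_six]
  ring

set_option maxHeartbeats 4000000 in
/-- Certificate check at coordinate `(1, 1)`. [folklore] -/
private theorem cert_1_1 : LC ((1 : Fin 6), (1 : Fin 6)) = 24 * x 1 1 := by
  simp [LC, actM_one_right_apply, actM_one_left_apply, Dh, RXm, RXm', rνf, rX, rX', rν, pairOf,
    complIdx, shSign, sh2, compl, s0, s0A, yv, starMuR, Fin.sum_univ_six]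
  ring

set_option maxHeartbeats 4000000 in
/-- Certificate check at coordinate `(1, 2)`. [folklore] -/
private theorem cert_1_2 : LC ((1 : Fin 6), (2 : Fin 6)) = 24 * x 1 2 := by
  simp [LC, actM_one_right_apply, actM_one_left_apply, Dh, RXm, RXm', rνf, rX, rX', rν, pairOf,
    complIdx, shSign, sh2, compl, s0, s0A, yv, starMuR, Fin.sum_univ_six]
  ring

set_option maxHeartbeats 4000000 in
/-- Certificate check at coordinate `(1, 3)`. [folklore] -/
private theorem cert_1_3 : LC ((1 : Fin 6), (3 : Fin 6)) = 24 * x 1 3 := by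
  simp [LC, actM_one_right_apply, actM_one_left_apply, Dh, RXm, RXm', rνf, rX, rX', rν, pairOf,
    complIdx, shSign, sh2, compl, s0, s0A, yv, starMuR, Fin.sum_univ_six]
  ring

set_option maxHeartbeats 4000000 in
/-- Certificate check at coordinate `(1, 4)`. [folklore] -/
private theorem cert_1_4 : LC ((1 : Fin 6), (4 : Fin 6)) = 24 * x 1 4 := by
  simp [LC, actM_one_right_apply, actM_one_left_apply, Dh, RXm, RXm', rνf, rX, rX', rν, pairOf,
    complIdx, shSign, sh2, compl, s0, s0A, yv, starMuR, Fin.sum_univ_six]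
  ring

set_option maxHeartbeats 4000000 in
/-- Certificate check at coordinate `(1, 5)`. [folklore] -/
private theorem cert_1_5 : LC ((1 : Fin 6), (5 : Fin 6)) = 24 * x 1 5 := by
  simp [LC, actM_one_right_apply, actM_one_left_apply, Dh, RXm, RXm', rνf, rX, rX', rν, pairOf,
    complIdx, shSign, sh2, compl, s0, s0A, yv, starMuR, Fin.sum_univ_six]
  ring

set_option maxHeartbeats 4000000 in
/-- Certificate check at coordinate `(2, 0)`. [folklore] -/
private theorem cert_2_0 : LC ((2 : Fin 6), (0 : Fin 6)) = 24 * x 2 0 := by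
  simp [LC, actM_one_right_apply, actM_one_left_apply, Dh, RXm, RXm', rνf, rX, rX', rν, pairOf,
    complIdx, shSign, sh2, compl, s0, s0A, yv, starMuR, Fin.sum_univ_six]
  ring

set_option maxHeartbeats 4000000 in
/-- Certificate check at coordinate `(2, 1)`. [folklore] -/
private theorem cert_2_1 : LC ((2 : Fin 6), (1 : Fin 6)) = 24 * x 2 1 := by
  simp [LC, actM_one_right_apply, actM_one_left_apply, Dh, RXm, RXm', rνf, rX, rX', rν, pairOf,
    complIdx, shSign, sh2, compl, s0, s0A, yv, starMuR, Fin.sum_univ_six]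
  ring

set_option maxHeartbeats 4000000 in
/-- Certificate check at coordinate `(2, 2)`. [folklore] -/
private theorem cert_2_2 : LC ((2 : Fin 6), (2 : Fin 6)) = 24 * x 2 2 := by
  simp [LC, actM_one_right_apply, actM_one_left_apply, Dh, RXm, RXm', rνf, rX, rX', rν, pairOf,
    complIdx, shSign, sh2, compl, s0, s0A, yv, starMuR, Fin.sum_univ_six]
  ring

set_option maxHeartbeats 4000000 in
/-- Certificate check at coordinate `(2, 3)`. [folklore] -/
private theorem cert_2_3 : LC ((2 : Fin 6), (3 : Fin 6)) = 24 * x 2 3 := by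
  simp [LC, actM_one_right_apply, actM_one_left_apply, Dh, RXm, RXm', rνf, rX, rX', rν, pairOf,
    complIdx, shSign, sh2, compl, s0, s0A, yv, starMuR, Fin.sum_univ_six]
  ring

set_option maxHeartbeats 4000000 in
/-- Certificate check at coordinate `(2, 4)`. [folklore] -/
private theorem cert_2_4 : LC ((2 : Fin 6), (4 : Fin 6)) = 24 * x 2 4 := by
  simp [LC, actM_one_right_apply, actM_one_left_apply, Dh, RXm, RXm', rνf, rX, rX', rν, pairOf,
    complIdx, shSign, sh2, compl, s0, s0A, yv, starMuR, Fin.sum_univ_six]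
  ring

set_option maxHeartbeats 4000000 in
/-- Certificate check at coordinate `(2, 5)`. [folklore] -/
private theorem cert_2_5 : LC ((2 : Fin 6), (5 : Fin 6)) = 24 * x 2 5 := by
  simp [LC, actM_one_right_apply, actM_one_left_apply, Dh, RXm, RXm', rνf, rX, rX', rν, pairOf,
    complIdx, shSign, sh2, compl, s0, s0A, yv, starMuR, Fin.sum_univ_six]
  ring

set_option maxHeartbeats 4000000 in
/-- Certificate check at coordinate `(3, 0)`. [folklore] -/
private theorem cert_3_0 : LC ((3 : Fin 6), (0 : Fin 6)) = 24 * x 3 0 := by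
  simp [LC, actM_one_right_apply, actM_one_left_apply, Dh, RXm, RXm', rνf, rX, rX', rν, pairOf,
    complIdx, shSign, sh2, compl, s0, s0A, yv, starMuR, Fin.sum_univ_six]
  ring

set_option maxHeartbeats 4000000 in
/-- Certificate check at coordinate `(3, 1)`. [folklore] -/
private theorem cert_3_1 : LC ((3 : Fin 6), (1 : Fin 6)) = 24 * x 3 1 := by
  simp [LC, actM_one_right_apply, actM_one_left_apply, Dh, RXm, RXm', rνf, rX, rX', rν, pairOf,
    complIdx, shSign, sh2, compl, s0, s0A, yv, starMuR, Fin.sum_univ_six]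
  ring

set_option maxHeartbeats 4000000 in
/-- Certificate check at coordinate `(3, 2)`. [folklore] -/
private theorem cert_3_2 : LC ((3 : Fin 6), (2 : Fin 6)) = 24 * x 3 2 := by
  simp [LC, actM_one_right_apply, actM_one_left_apply, Dh, RXm, RXm', rνf, rX, rX', rν, pairOf,
    complIdx, shSign, sh2, compl, s0, s0A, yv, starMuR, Fin.sum_univ_six]
  ring

set_option maxHeartbeats 4000000 in
/-- Certificate check at coordinate `(3, 3)`. [folklore] -/
private theorem cert_3_3 : LC ((3 : Fin 6), (3 : Fin 6)) = 24 * x 3 3 := by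
  simp [LC, actM_one_right_apply, actM_one_left_apply, Dh, RXm, RXm', rνf, rX, rX', rν, pairOf,
    complIdx, shSign, sh2, compl, s0, s0A, yv, starMuR, Fin.sum_univ_six]
  ring

set_option maxHeartbeats 4000000 in
/-- Certificate check at coordinate `(3, 4)`. [folklore] -/
private theorem cert_3_4 : LC ((3 : Fin 6), (4 : Fin 6)) = 24 * x 3 4 := by
  simp [LC, actM_one_right_apply, actM_one_left_apply, Dh, RXm, RXm', rνf, rX, rX', rν, pairOf,
    complIdx, shSign, sh2, compl, s0, s0A, yv, starMuR, Fin.sum_univ_six]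
  ring

set_option maxHeartbeats 4000000 in
/-- Certificate check at coordinate `(3, 5)`. [folklore] -/
private theorem cert_3_5 : LC ((3 : Fin 6), (5 : Fin 6)) = 24 * x 3 5 := by
  simp [LC, actM_one_right_apply, actM_one_left_apply, Dh, RXm, RXm', rνf, rX, rX', rν, pairOf,
    complIdx, shSign, sh2, compl, s0, s0A, yv, starMuR, Fin.sum_univ_six]
  ring

set_option maxHeartbeats 4000000 in
/-- Certificate check at coordinate `(4, 0)`. [folklore] -/
private theorem cert_4_0 : LC ((4 : Fin 6), (0 : Fin 6)) = 24 * x 4 0 := by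
  simp [LC, actM_one_right_apply, actM_one_left_apply, Dh, RXm, RXm', rνf, rX, rX', rν, pairOf,
    complIdx, shSign, sh2, compl, s0, s0A, yv, starMuR, Fin.sum_univ_six]
  ring

set_option maxHeartbeats 4000000 in
/-- Certificate check at coordinate `(4, 1)`. [folklore] -/
private theorem cert_4_1 : LC ((4 : Fin 6), (1 : Fin 6)) = 24 * x 4 1 := by
  simp [LC, actM_one_right_apply, actM_one_left_apply, Dh, RXm, RXm', rνf, rX, rX', rν, pairOf,
    complIdx, shSign, sh2, compl, s0, s0A, yv, starMuR, Fin.sum_univ_six]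
  ring

set_option maxHeartbeats 4000000 in
/-- Certificate check at coordinate `(4, 2)`. [folklore] -/
private theorem cert_4_2 : LC ((4 : Fin 6), (2 : Fin 6)) = 24 * x 4 2 := by
  simp [LC, actM_one_right_apply, actM_one_left_apply, Dh, RXm, RXm', rνf, rX, rX', rν, pairOf,
    complIdx, shSign, sh2, compl, s0, s0A, yv, starMuR, Fin.sum_univ_six]
  ring

set_option maxHeartbeats 4000000 in
/-- Certificate check at coordinate `(4, 3)`. [folklore] -/
private theorem cert_4_3 : LC ((4 : Fin 6), (3 : Fin 6)) = 24 * x 4 3 := by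
  simp [LC, actM_one_right_apply, actM_one_left_apply, Dh, RXm, RXm', rνf, rX, rX', rν, pairOf,
    complIdx, shSign, sh2, compl, s0, s0A, yv, starMuR, Fin.sum_univ_six]
  ring

set_option maxHeartbeats 4000000 in
/-- Certificate check at coordinate `(4, 4)`. [folklore] -/
private theorem cert_4_4 : LC ((4 : Fin 6), (4 : Fin 6)) = 24 * x 4 4 := by
  simp [LC, actM_one_right_apply, actM_one_left_apply, Dh, RXm, RXm', rνf, rX, rX', rν, pairOf,
    complIdx, shSign, sh2, compl, s0, s0A, yv, starMuR, Fin.sum_univ_six]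
  ring

set_option maxHeartbeats 4000000 in
/-- Certificate check at coordinate `(4, 5)`. [folklore] -/
private theorem cert_4_5 : LC ((4 : Fin 6), (5 : Fin 6)) = 24 * x 4 5 := by
  simp [LC, actM_one_right_apply, actM_one_left_apply, Dh, RXm, RXm', rνf, rX, rX', rν, pairOf,
    complIdx, shSign, sh2, compl, s0, s0A, yv, starMuR, Fin.sum_univ_six]
  ring

set_option maxHeartbeats 4000000 in
/-- Certificate check at coordinate `(5, 0)`. [folklore] -/
private theorem cert_5_0 : LC ((5 : Fin 6), (0 : Fin 6)) = 24 * x 5 0 := by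
  simp [LC, actM_one_right_apply, actM_one_left_apply, Dh, RXm, RXm', rνf, rX, rX', rν, pairOf,
    complIdx, shSign, sh2, compl, s0, s0A, yv, starMuR, Fin.sum_univ_six]
  ring

set_option maxHeartbeats 4000000 in
/-- Certificate check at coordinate `(5, 1)`. [folklore] -/
private theorem cert_5_1 : LC ((5 : Fin 6), (1 : Fin 6)) = 24 * x 5 1 := by
  simp [LC, actM_one_right_apply, actM_one_left_apply, Dh, RXm, RXm', rνf, rX, rX', rν, pairOf,
    complIdx, shSign, sh2, compl, s0, s0A, yv, starMuR, Fin.sum_univ_six]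
  ring

set_option maxHeartbeats 4000000 in
/-- Certificate check at coordinate `(5, 2)`. [folklore] -/
private theorem cert_5_2 : LC ((5 : Fin 6), (2 : Fin 6)) = 24 * x 5 2 := by
  simp [LC, actM_one_right_apply, actM_one_left_apply, Dh, RXm, RXm', rνf, rX, rX', rν, pairOf,
    complIdx, shSign, sh2, compl, s0, s0A, yv, starMuR, Fin.sum_univ_six]
  ring

set_option maxHeartbeats 4000000 in
/-- Certificate check at coordinate `(5, 3)`. [folklore] -/
private theorem cert_5_3 : LC ((5 : Fin 6), (3 : Fin 6)) = 24 * x 5 3 := by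
  simp [LC, actM_one_right_apply, actM_one_left_apply, Dh, RXm, RXm', rνf, rX, rX', rν, pairOf,
    complIdx, shSign, sh2, compl, s0, s0A, yv, starMuR, Fin.sum_univ_six]
  ring

set_option maxHeartbeats 4000000 in
/-- Certificate check at coordinate `(5, 4)`. [folklore] -/
private theorem cert_5_4 : LC ((5 : Fin 6), (4 : Fin 6)) = 24 * x 5 4 := by
  simp [LC, actM_one_right_apply, actM_one_left_apply, Dh, RXm, RXm', rνf, rX, rX', rν, pairOf,
    complIdx, shSign, sh2, compl, s0, s0A, yv, starMuR, Fin.sum_univ_six]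
  ring

set_option maxHeartbeats 4000000 in
/-- Certificate check at coordinate `(5, 5)`. [folklore] -/
private theorem cert_5_5 : LC ((5 : Fin 6), (5 : Fin 6)) = 24 * x 5 5 := by
  simp [LC, actM_one_right_apply, actM_one_left_apply, Dh, RXm, RXm', rνf, rX, rX', rν, pairOf,
    complIdx, shSign, sh2, compl, s0, s0A, yv, starMuR, Fin.sum_univ_six]
  ring

/-- The certificate: `r ∘ L = 24 · id` on coordinates. [folklore] -/
private theorem cert (τ : Typ) : LC τ = 24 * X τ := by
  obtain ⟨a, c⟩ := τ
  fin_cases a <;> fin_cases c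
  exacts [cert_0_0, cert_0_1, cert_0_2, cert_0_3, cert_0_4, cert_0_5, cert_1_0, cert_1_1, cert_1_2, cert_1_3, cert_1_4, cert_1_5, cert_2_0, cert_2_1, cert_2_2, cert_2_3, cert_2_4, cert_2_5, cert_3_0, cert_3_1, cert_3_2, cert_3_3, cert_3_4, cert_3_5, cert_4_0, cert_4_1, cert_4_2, cert_4_3, cert_4_4, cert_4_5, cert_5_0, cert_5_1, cert_5_2, cert_5_3, cert_5_4, cert_5_5]

end Certificate

/-! ### Assembly -/

section Assembly

/-- `P(μ) = F(⋆⋆μ) - F(μ)` as a polynomial in the `36` coordinates. [folklore] -/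
noncomputable def Pgen : MvPolynomial Typ ℚ := FG (X : Typ → MvPolynomial Typ ℚ)

/-- `Q(μ) = P(s₀ + μ)`. [folklore] -/
noncomputable def Qsh : MvPolynomial Typ ℚ := bind₁ (fun τ => C (s0 τ : ℚ) + X τ) Pgen

/-- Evaluating the generic `P`. [folklore] -/
private theorem aeval_Pgen {A : Type*} [CommRing A] [Algebra ℚ A] (μ : Typ → A) : aeval μ Pgen = FG μ := by
  have h := map_FG (aeval μ).toRingHom (X : Typ → MvPolynomial Typ ℚ)
  have hX : ((aeval μ).toRingHom : MvPolynomial Typ ℚ → A) ∘ (X : Typ → MvPolynomial Typ ℚ) = μ := by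
    funext τ; simp
  rw [hX] at h
  exact h

/-- `Q(εψ) = 0`. [folklore] -/
private theorem aeval_εψ_Qsh : aeval (fun τ => (Polynomial.X : Bε) * ψ τ) Qsh = 0 := by
  rw [Qsh, aeval_bind₁]
  have h : (fun τ => aeval (fun τ => (Polynomial.X : Bε) * ψ τ) (C (s0 τ : ℚ) + X τ)) =
      s0A Bε + (Polynomial.X : Bε) • ψ := by
    funext τ; simp [s0A]
  rw [h, aeval_Pgen, ← dil_Φh, ← map_FG, FG_Φh, map_zero]

/-- A homogeneous component of `Q` killed by `L` vanishes. [folklore] -/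
private theorem homogeneousComponent_Qsh_eq_zero (d : ℕ)
    (h : aeval Lh (homogeneousComponent d Qsh) = 0) : homogeneousComponent d Qsh = 0 := by
  have h1 := congrArg (bind₁ r) h
  rw [map_zero, ← AlgHom.comp_apply, comp_aeval, bind_r_Lh] at h1
  have hLC : (LC : Typ → MvPolynomial Typ ℚ) = fun τ => (24 : MvPolynomial Typ ℚ) * X τ := by
    funext τ; exact cert τ
  rw [hLC, aeval_mul_homogeneousComponent, aeval_X_left_apply] at h1
  have h24 : (24 : MvPolynomial Typ ℚ) ^ d ≠ 0 := by
    apply pow_ne_zero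
    rw [show (24 : MvPolynomial Typ ℚ) = C 24 from (map_ofNat C 24).symm, Ne, C_eq_zero]
    norm_num
  exact (mul_eq_zero.mp h1).resolve_left h24

/-- `Q = 0`. [folklore] -/
private theorem Qsh_eq_zero : Qsh = 0 := by
  have hc : ∀ d, homogeneousComponent d Qsh = 0 := by
    intro d
    induction d using Nat.strong_induction_on with
    | _ d ih =>
      apply homogeneousComponent_Qsh_eq_zero
      have h := lowest_order Qsh ψ d ih aeval_εψ_Qsh
      rwa [eval0_ψ] at h
  rw [← sum_homogeneousComponent Qsh]
  exact Finset.sum_eq_zero fun d _ => hc d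

/-- `P = 0`: `F(⋆⋆μ) = F(μ)` as polynomials over `ℚ`. [folklore] -/
private theorem Pgen_eq_zero : Pgen = 0 := by
  have h : bind₁ (fun τ => X τ - C (s0 τ : ℚ)) Qsh = Pgen := by
    rw [Qsh, bind₁_bind₁]
    have : (fun τ => bind₁ (fun τ => X τ - C (s0 τ : ℚ)) (C (s0 τ : ℚ) + X τ)) =
        (X : Typ → MvPolynomial Typ ℚ) := by
      funext τ; simp
    rw [this, bind₁_X_left, AlgHom.id_apply]
  rw [← h, Qsh_eq_zero, map_zero]

/-- `F(⋆⋆μ) = F(μ)` over `ℚ`. [folklore] -/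
private theorem FG_eq_zero_rat (μ : Typ → ℚ) : FG μ = 0 := by
  rw [← aeval_Pgen μ, Pgen_eq_zero, map_zero]

/-- **The double-Hodge-star identity** `det K(⋆⋆μ) = det K(μ)` for all integer coefficient
vectors `μ ∈ Λ²ℤ⁴ ⊗ Λ²ℤ⁴` (`F = det K` is a relative `GL₄ × GL₄`-invariant, `⋆ ⊗ ⋆` normalises the
action and fixes the slice `𝔰` pointwise, and `GL₄ × GL₄ · 𝔰` is Zariski dense).
[cite: BurgisserIkenmeyer2017, §5.2 (before Problem 5.23); §3.3 (after Prop. 3.28)] -/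
theorem detK_star_invariant (μ : Typ → ℤ) : (kMat (starMu μ)).det = (kMat μ).det := by
  have h : (Int.castRingHom ℚ) (FG μ) = 0 := by
    rw [map_FG]; exact FG_eq_zero_rat _
  have h' : FG μ = 0 := by simpa using h
  have e1 : ∀ ν : Typ → ℤ, kMatR ν = kMat ν := fun ν => by ext x y; simp [kMatR, kMat]
  have e2 : starMuR μ = starMu μ := by funext τ; simp [starMuR, starMu]
  simp only [FG, e1, e2] at h'
  exact sub_eq_zero.mp h'

end Assembly

/-! ### The unconditional consequences (BI 2017's two computer verifications at `n = 4`) -/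

/-- **`N_4 > 0`**: the signed count of admissible `4`-tables is positive (in fact
`Σ_t D_t² ≥ 1`), unconditionally; with Prop. 3.28 this is BI 2017's "we have verified that
`P_{4,16}(det_4)` [is] nonzero, using computer calculations" — here by algebra (two-level cut,
polarization, and the double-Hodge-star identity `detK_star_invariant`), no enumeration.
[cite: BurgisserIkenmeyer2017, §3.3 (after Prop. 3.28)] -/
theorem admissibleTableCount_four_pos : 0 < admissibleTableCount 4 :=
  admissibleTableCount_four_pos_of_detK_star detK_star_invariant

/-- **`P_{4,16}(det_4) ≠ 0`**: the fundamental invariant `P_{4,16}` does not vanish at `det_4`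
(BI 2017, §3.3 after Prop. 3.28: "verified … using computer calculations"; equivalently, §5.2 before
Problem 5.23, the Latin-cube count at `n = 4` is nonzero — the Summit-side
`BI2017_latinCube_2_4_iff_cayleyP_det_four` turns this into `BI2017_latinCube_2_4`).
[cite: BurgisserIkenmeyer2017, §3.3 (after Prop. 3.28); §5.2 (before Problem 5.23)] -/
theorem cayleyP_det_four_ne_zero :
    MvPolynomial.aeval (formCoeff 4 (detPoly (Fin 4) ℂ))
      (cayleyP (k := ℂ) 4 (finProdFinEquiv.symm : Fin (4 * 4) ≃ Fin 4 × Fin 4)) ≠ 0 :=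
  cayleyP_det_four_ne_zero_of_detK_star detK_star_invariant

end Literature.Computability.AlgebraicComplexity.BI17TwoLevelCut
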